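import Summits.CriticalPhenomena.SAWScalingLimit.Theorems.SAWTwistedSelfEnergySubseqIdentificationParaObsNatural
import Literature.Probability.RandomPlanarGeometry.SAWParaObservableFarField
import Literature.Probability.RandomPlanarGeometry.SAWParaObservableShortTime
import Literature.Probability.Process.LocalMartingaleFromObservables
import Literature.Probability.RandomPlanarGeometry.SLELawOfDrivingProcessLocal
import Literature.Probability.RandomPlanarGeometry.DrivingFunctionMeasurable
import Literature.Probability.RandomPlanarGeometry.LoewnerDescription
import HarnessLib

/-!
# `stub_paraObservableCharacterisesSLECap`: the time-capped parafermionic martingales characterise SLE(8/3)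

Stub S4 of the registered skeleton (lead c6, reshape r-c6-2) of the line `parafermionic-martingale`
for the crux `SubseqIdentification` (stmt-CriticalPhenomena-0783, route `SAWTwistedSelfEnergy`, shared
with `SAWRenewalTightness` / `SAWParafermion` / …; vocabulary
`Theorems/SAWTwistedSelfEnergyParaMartingaleDefs.lean`): the CONTINUUM ENDGAME of the line. If `ν` is a
probability measure on curve classes, `ν`-a.e. class is Loewner-describable through the chordal
uniformizing map `φ` and starts at `a = D.pt 0`, the driving process `W = drivingFunction φ` is adapted
to a filtration `𝓕`, and for every `w ∈ ℍ` the TIME-CAPPED spin-`5/8` observable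
`t ↦ N_{t ∧ T_w}(w) = paraObsCap W w t`, `T_w = (Im w)²/16`
(`N_t(w) = (w² g_t'(w)/(g_t(w) - W_t)²)^{5/8}`, principal logarithms), is an `𝓕`-martingale, then `ν`
is the chordal SLE(8/3) law of `(D; a, b)`.

Proof (the martingale-observable principle of Lawler–Schramm–Werner / Smirnov at the exponent `5/8`;
a port of the room line's capped endgame `stub_roomEntropyCharacterisesSLECap`, p105444, and of the
`κ = 6` twin `ParaObservableSLESix`). Only FAR points `w = iy`, `y ≥ 64 (K + √T) + 1`, and times
`r ≤ T ≤ y²/4096 ≤ T_w` are ever looked at, so the cap is inactive (`paraObsCap_eq_paraObs_of_le`).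
There the LANDED far-field expansion of the spin-5/8 observable
(`Loewner.FarRegime.abs_im_sawParaObservable_add_le` / `abs_re_sawParaObservable_sub_le`,
`Literature/…/SAWParaObservableFarField.lean`, p166579),
`N = 1 + (5/4) W/(iy) + (45/32)(W² - (8/3) t)/(iy)² + O(((K + √t)/y)³)`, gives the two approximation
statements `exists_level_paraObsCap_order_one` (imaginary part, coefficient `-5/(4y) ≠ 0` of `W_r`)
and `exists_level_paraObsCap_order_two` (real part, `-(45/32)(W_r² - (8/3) r)/y²`), which feed the
exit-time localisation `Literature.Probability.Process.isLocalMartingale_hasQuadraticVariation_of_approx`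
(real and imaginary parts of the complex martingale are martingales, `martingale_re_of_complex` /
`martingale_im_of_complex` via `ContinuousLinearMap.comp_condExp_comm`; continuity of the capped paths
from the LANDED `Loewner.continuous_sawParaObservable_min`, p166585); the tree's
`isSLELaw_of_isLocalMartingale_driving_of_lt_four` (`0 < 8/3 < 4`; `W_0 = 0` a.e. from
`drivingFunction_apply_zero`; describability read as `Loewner.IsDrivenBy`) concludes.

No named fact is used; axioms `propext`, `Classical.choice`, `Quot.sound`.

References: G. F. Lawler, O. Schramm, W. Werner, Proc. Sympos. Pure Math. 72 (2004), §4.1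
(martingale-observable identification of the SAW limit at `κ = 8/3`); H. Duminil-Copin, S. Smirnov,
Ann. of Math. 175 (2012), §4 (the spin-5/8 observable, Conjecture 2); D. Chelkak, H. Duminil-Copin,
C. Hongler, A. Kemppainen, S. Smirnov, C. R. Math. Acad. Sci. Paris 352 (2014), §3 (deterministic time
cap at a far point); D. Revuz, M. Yor (1999), Ch. IV (3.6) (Lévy's characterisation).
-/

noncomputable section

open MeasureTheory Filter Topology Set
open scoped NNReal ENNReal Classical BigOperators
open Literature.Probability.LatticeModels
open Literature.Probability.RandomPlanarGeometry
open UpperHalfPlane (upperHalfPlaneSet)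

namespace Summit.CriticalPhenomena.SAWScalingLimit.Theorems.SubseqIdentification.ParaMartingale

open Summit.CriticalPhenomena.SAWScalingLimit.Theorems.SubseqIdentification.RoomEntropy (capTimeOf)

/-! ## The cap is inactive up to `(Im w)²/16`; continuity of the capped observable -/

/-- **Below the cap time the capped observable is the raw one**: `paraObsCap W w r = paraObs W w r`
for `r ≤ (Im w)²/16`. [folklore] -/
theorem paraObsCap_eq_paraObs_of_le {W : ℝ≥0 → ℝ} {w : ℂ} {r : ℝ≥0} (hr : (r : ℝ) ≤ w.im ^ 2 / 16) :
    paraObsCap W w r = paraObs W w r := by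
  have h : r ≤ capTimeOf w := by
    rw [RoomEntropy.capTimeOf]
    exact (Real.le_toNNReal_iff_coe_le (by positivity)).2 hr
  rw [paraObsCap, min_eq_left h]

/-- **The capped spin-5/8 observable at `iy` has continuous paths**: for a continuous driving
function and `y > 0`, `t ↦ paraObsCap W (iy) t` is continuous (the cap time `y²/16` lies in the
short-time regime, where both arguments of the principal logarithm stay in the slit plane:
`Loewner.continuous_sawParaObservable_min`). [folklore] -/
theorem continuous_paraObsCap {W : ℝ≥0 → ℝ} (hW : Continuous W) {y : ℝ} (hy : 0 < y) :
    Continuous fun t : ℝ≥0 ↦ paraObsCap W (Complex.I * y) t := by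
  have hw : 0 < (Complex.I * y : ℂ).im := by simpa using hy
  have h : Loewner.ShortTime W (Complex.I * y) (capTimeOf (Complex.I * y)) := by
    have := shortTime_min_capTimeOf hW hw (capTimeOf (Complex.I * y))
    rwa [min_self] at this
  exact Loewner.continuous_sawParaObservable_min h

/-! ## Real and imaginary parts of a complex martingale -/

section ReIm

variable {Ω : Type*} {mΩ : MeasurableSpace Ω} {P : Measure Ω} {𝓕 : Filtration ℝ≥0 mΩ}
  {f : ℝ≥0 → Ω → ℂ}

/-- The real part of a complex-valued martingale is a real martingale (conditional expectation
commutes with the continuous `ℝ`-linear map `re`, `ContinuousLinearMap.comp_condExp_comm`).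
[folklore] -/
theorem martingale_re_of_complex (hf : Martingale f 𝓕 P) :
    Martingale (fun t ω ↦ (f t ω).re) 𝓕 P := by
  refine ⟨fun t ↦ Complex.continuous_re.comp_stronglyMeasurable (hf.1 t), fun s t hst ↦ ?_⟩
  show P[fun ω ↦ (f t ω).re | 𝓕 s] =ᵐ[P] fun ω ↦ (f s ω).re
  have h3 : (fun ω ↦ (f t ω).re) = (Complex.reCLM : ℂ →L[ℝ] ℝ) ∘ f t := by
    funext ω; simp
  rw [h3]
  refine ((Complex.reCLM : ℂ →L[ℝ] ℝ).comp_condExp_comm (hf.integrable t)).symm.trans ?_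
  filter_upwards [hf.2 s t hst] with ω hω
  simp [Function.comp_apply, hω]

/-- The imaginary part of a complex-valued martingale is a real martingale. [folklore] -/
theorem martingale_im_of_complex (hf : Martingale f 𝓕 P) :
    Martingale (fun t ω ↦ (f t ω).im) 𝓕 P := by
  refine ⟨fun t ↦ Complex.continuous_im.comp_stronglyMeasurable (hf.1 t), fun s t hst ↦ ?_⟩
  show P[fun ω ↦ (f t ω).im | 𝓕 s] =ᵐ[P] fun ω ↦ (f s ω).im
  have h3 : (fun ω ↦ (f t ω).im) = (Complex.imCLM : ℂ →L[ℝ] ℝ) ∘ f t := by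
    funext ω; simp
  rw [h3]
  refine ((Complex.imCLM : ℂ →L[ℝ] ℝ).comp_condExp_comm (hf.integrable t)).symm.trans ?_
  filter_upwards [hf.2 s t hst] with ω hω
  simp [Function.comp_apply, hω]

end ReIm

/-! ## The two capped approximation statements in the far field -/

/-- Far-field regime at `iy` from a pointwise driver bound on `[0, r]` and `64 (K + √r) ≤ y`.
[folklore] -/
theorem farRegime_I_mul_of_bound {W : ℝ≥0 → ℝ} (hW : Continuous W) {K y : ℝ} {r : ℝ≥0}
    (hbd : ∀ u, u ≤ r → |W u| ≤ K) (hfar : 64 * (K + Real.sqrt r) ≤ y) (hy : 0 < y) :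
    Loewner.FarRegime W (Complex.I * y) r K := by
  have hnorm : ‖(Complex.I * y : ℂ)‖ = y := by simp [abs_of_pos hy]
  refine ⟨hW, fun u hu ↦ hbd _ ?_, by rw [hnorm]; exact hfar, by rw [hnorm]; exact hy⟩
  have := Real.toNNReal_le_toNNReal hu.2
  rwa [Real.toNNReal_coe] at this

/-- **Order one (the driver), capped spin-5/8 form.** For every driver bound `K ≥ 0`, horizon `T`
and `ε > 0` there is a level `y > 0` such that, for EVERY continuous driving function `W` and every
time `r ≤ T` with `|W| ≤ K` on `[0, r]`, the imaginary part of the capped observable at `iy`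
satisfies `|Im N_{r ∧ T_w}(iy) - a W_r| ≤ ε |a|` with the nonzero constant `a = -5/(4y)`:
`y ≥ 64 (K + √T) + 1` forces `T ≤ y²/4096 ≤ T_w = y²/16`, so the cap is inactive and the far-field
expansion `Loewner.FarRegime.abs_im_sawParaObservable_add_le` applies. [folklore] -/
theorem exists_level_paraObsCap_order_one {K : ℝ} (hK : 0 ≤ K) (T : ℝ≥0) {ε : ℝ} (hε : 0 < ε) :
    ∃ y : ℝ, 0 < y ∧ ∀ (W : ℝ≥0 → ℝ), Continuous W → ∀ r : ℝ≥0, r ≤ T →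
      (∀ u, u ≤ r → |W u| ≤ K) →
      |(paraObsCap W (Complex.I * y) r).im - (-(5 / (4 * y)) * W r + 0)| ≤
        ε * |-(5 / (4 * y))| := by
  set M := K + Real.sqrt T with hMdef
  have hM0 : 0 ≤ M := add_nonneg hK (Real.sqrt_nonneg _)
  set y : ℝ := max (64 * M) (80 * M ^ 3 / ε) + 1 with hydef
  have hy64 : 64 * M ≤ y := by
    have : 64 * M ≤ max (64 * M) (80 * M ^ 3 / ε) := le_max_left _ _
    rw [hydef]; linarith
  have hy2 : 80 * M ^ 3 / ε ≤ y := by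
    have : 80 * M ^ 3 / ε ≤ max (64 * M) (80 * M ^ 3 / ε) := le_max_right _ _
    rw [hydef]; linarith
  have hy1 : 1 ≤ y := by
    have : (0 : ℝ) ≤ max (64 * M) (80 * M ^ 3 / ε) := le_trans (by positivity) (le_max_left _ _)
    rw [hydef]; linarith
  have hy : 0 < y := by linarith
  refine ⟨y, hy, fun W hW r hr hbd ↦ ?_⟩
  have hrT' : (r : ℝ) ≤ T := NNReal.coe_le_coe.2 hr
  have hrT : Real.sqrt r ≤ Real.sqrt T := Real.sqrt_le_sqrt hrT'
  have hKr : K + Real.sqrt r ≤ M := by rw [hMdef]; linarith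
  have hfar : 64 * (K + Real.sqrt r) ≤ y := by linarith
  have hreg : Loewner.FarRegime W (Complex.I * y) r K := farRegime_I_mul_of_bound hW hbd hfar hy
  have hTy : (T : ℝ) ≤ y ^ 2 / 4096 := by
    have h0 : 0 ≤ Real.sqrt T := Real.sqrt_nonneg _
    have h1 : Real.sqrt T ^ 2 = T := Real.sq_sqrt T.coe_nonneg
    have h2 : 64 * Real.sqrt T ≤ y := by rw [hMdef] at hy64; linarith
    nlinarith [mul_nonneg (sub_nonneg.2 h2)
      (add_nonneg hy.le (mul_nonneg (by norm_num : (0 : ℝ) ≤ 64) h0))]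
  have hcap : (r : ℝ) ≤ (Complex.I * y : ℂ).im ^ 2 / 16 := by
    have him : (Complex.I * y : ℂ).im = y := by simp
    rw [him]; nlinarith [sq_nonneg y]
  rw [paraObsCap_eq_paraObs_of_le hcap]
  have hexp : |(paraObs W (Complex.I * y) r).im + 5 / (4 * y) * W r| ≤
      100 * ((K + Real.sqrt r) / y) ^ 3 := hreg.abs_im_sawParaObservable_add_le hy
  have hid : (paraObs W (Complex.I * y) r).im - (-(5 / (4 * y)) * W r + 0) =
      (paraObs W (Complex.I * y) r).im + 5 / (4 * y) * W r := by ring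
  have ha : |-(5 / (4 * y))| = 5 / (4 * y) := by
    rw [abs_neg, abs_of_pos (by positivity)]
  rw [hid, ha]
  refine hexp.trans ?_
  have h0 : 0 ≤ (K + Real.sqrt r) / y := by positivity
  have h1 : (K + Real.sqrt r) / y ≤ M / y := by gcongr
  have key : 80 * M ^ 3 ≤ ε * y ^ 2 := by
    have h2 : 80 * M ^ 3 ≤ y * ε := (div_le_iff₀ hε).1 hy2
    nlinarith [mul_le_mul_of_nonneg_left hy1 (mul_nonneg hy.le hε.le)]
  have hy3 : 0 < y ^ 3 := by positivity
  calc 100 * ((K + Real.sqrt r) / y) ^ 3 ≤ 100 * (M / y) ^ 3 := by gcongr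
    _ = 100 * M ^ 3 / y ^ 3 := by rw [div_pow]; ring
    _ ≤ (5 / 4 * ε * y ^ 2) / y ^ 3 := div_le_div_of_nonneg_right (by nlinarith [key]) hy3.le
    _ = ε * (5 / (4 * y)) := by field_simp

/-- **Order two (the quadratic), capped spin-5/8 form.** For every `K ≥ 0`, `T` and `ε > 0` there
is a level `y > 0` such that, for every continuous `W` and every `r ≤ T` with `|W| ≤ K` on `[0, r]`,
the real part of the capped observable at `iy` satisfies
`|Re N_{r ∧ T_w}(iy) - (a (W_r² - (8/3) r) + 1)| ≤ ε |a|` with the nonzero constant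
`a = -45/(32 y²)` (far-field expansion `Loewner.FarRegime.abs_re_sawParaObservable_sub_le`): the
coefficient `W_r² - (8/3) r` is what singles out `κ = 8/3`. [folklore] -/
theorem exists_level_paraObsCap_order_two {K : ℝ} (hK : 0 ≤ K) (T : ℝ≥0) {ε : ℝ} (hε : 0 < ε) :
    ∃ y : ℝ, 0 < y ∧ ∀ (W : ℝ≥0 → ℝ), Continuous W → ∀ r : ℝ≥0, r ≤ T →
      (∀ u, u ≤ r → |W u| ≤ K) →
      |(paraObsCap W (Complex.I * y) r).re - (-(45 / (32 * y ^ 2)) * (W r ^ 2 - 8 / 3 * r) + 1)| ≤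
        ε * |-(45 / (32 * y ^ 2))| := by
  set M := K + Real.sqrt T with hMdef
  have hM0 : 0 ≤ M := add_nonneg hK (Real.sqrt_nonneg _)
  set y : ℝ := max (64 * M) (72 * M ^ 3 / ε) + 1 with hydef
  have hy64 : 64 * M ≤ y := by
    have : 64 * M ≤ max (64 * M) (72 * M ^ 3 / ε) := le_max_left _ _
    rw [hydef]; linarith
  have hy2 : 72 * M ^ 3 / ε ≤ y := by
    have : 72 * M ^ 3 / ε ≤ max (64 * M) (72 * M ^ 3 / ε) := le_max_right _ _
    rw [hydef]; linarith
  have hy1 : 1 ≤ y := by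
    have : (0 : ℝ) ≤ max (64 * M) (72 * M ^ 3 / ε) := le_trans (by positivity) (le_max_left _ _)
    rw [hydef]; linarith
  have hy : 0 < y := by linarith
  refine ⟨y, hy, fun W hW r hr hbd ↦ ?_⟩
  have hrT' : (r : ℝ) ≤ T := NNReal.coe_le_coe.2 hr
  have hrT : Real.sqrt r ≤ Real.sqrt T := Real.sqrt_le_sqrt hrT'
  have hKr : K + Real.sqrt r ≤ M := by rw [hMdef]; linarith
  have hfar : 64 * (K + Real.sqrt r) ≤ y := by linarith
  have hreg : Loewner.FarRegime W (Complex.I * y) r K := farRegime_I_mul_of_bound hW hbd hfar hy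
  have hTy : (T : ℝ) ≤ y ^ 2 / 4096 := by
    have h0 : 0 ≤ Real.sqrt T := Real.sqrt_nonneg _
    have h1 : Real.sqrt T ^ 2 = T := Real.sq_sqrt T.coe_nonneg
    have h2 : 64 * Real.sqrt T ≤ y := by rw [hMdef] at hy64; linarith
    nlinarith [mul_nonneg (sub_nonneg.2 h2)
      (add_nonneg hy.le (mul_nonneg (by norm_num : (0 : ℝ) ≤ 64) h0))]
  have hcap : (r : ℝ) ≤ (Complex.I * y : ℂ).im ^ 2 / 16 := by
    have him : (Complex.I * y : ℂ).im = y := by simp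
    rw [him]; nlinarith [sq_nonneg y]
  rw [paraObsCap_eq_paraObs_of_le hcap]
  have hexp : |(paraObs W (Complex.I * y) r).re - (1 - 45 / (32 * y ^ 2) * (W r ^ 2 - 8 / 3 * r))| ≤
      100 * ((K + Real.sqrt r) / y) ^ 3 := hreg.abs_re_sawParaObservable_sub_le hy
  have hid : (paraObs W (Complex.I * y) r).re - (-(45 / (32 * y ^ 2)) * (W r ^ 2 - 8 / 3 * r) + 1) =
      (paraObs W (Complex.I * y) r).re - (1 - 45 / (32 * y ^ 2) * (W r ^ 2 - 8 / 3 * r)) := by ring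
  have ha : |-(45 / (32 * y ^ 2))| = 45 / (32 * y ^ 2) := by
    rw [abs_neg, abs_of_pos (by positivity)]
  rw [hid, ha]
  refine hexp.trans ?_
  have h0 : 0 ≤ (K + Real.sqrt r) / y := by positivity
  have h1 : (K + Real.sqrt r) / y ≤ M / y := by gcongr
  have key : 72 * M ^ 3 ≤ ε * y := by
    have h2 : 72 * M ^ 3 ≤ y * ε := (div_le_iff₀ hε).1 hy2
    linarith
  have hy3 : 0 < y ^ 3 := by positivity
  calc 100 * ((K + Real.sqrt r) / y) ^ 3 ≤ 100 * (M / y) ^ 3 := by gcongr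
    _ = 100 * M ^ 3 / y ^ 3 := by rw [div_pow]; ring
    _ ≤ (45 / 32 * ε * y) / y ^ 3 :=
        div_le_div_of_nonneg_right (by nlinarith [key, pow_nonneg hM0 3]) hy3.le
    _ = ε * (45 / (32 * y ^ 2)) := by field_simp

/-! ## The capped endgame -/

/-- **The time-capped parafermionic martingales characterise SLE(8/3)** (registered stub
`stub_paraObservableCharacterisesSLECap`, S4 of the line `parafermionic-martingale`, crux
`SubseqIdentification`, stmt-CriticalPhenomena-0783): for a probability measure `ν` on curve classes
carried by Loewner-describable classes from `a = D.pt 0`, a filtration to which the driving process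
`drivingFunction φ` is adapted, and the martingale property, for every `w ∈ ℍ`, of the capped
spin-5/8 observable `t ↦ paraObsCap (drivingFunction φ c) w t`, the measure `ν` is the chordal
SLE(8/3) law of `D`. Proof: the two capped far-field channels on the imaginary axis
(`exists_level_paraObsCap_order_one`, imaginary part; `exists_level_paraObsCap_order_two`, real part)
feed the exit-time localisation `Process.isLocalMartingale_hasQuadraticVariation_of_approx`, and the
tree's `isSLELaw_of_isLocalMartingale_driving_of_lt_four` (`0 < 8/3 < 4`) concludes.
[cite: LawlerSchrammWerner2004SAW, §4.1] -/
theorem stub_paraObservableCharacterisesSLECap :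
    ∀ (D : DobrushinDomain) (φ : ConformalEquiv upperHalfPlaneSet D.carrier)
        (ν : Measure (CurveClass ℂ)),
        D.IsChordalUniformizing φ → IsProbabilityMeasure ν →
        (∀ᵐ c ∂ν, IsLoewnerDescribable φ c ∧ c.source = D.pt 0) →
        ∀ 𝓕 : Filtration ℝ≥0 (inferInstance : MeasurableSpace (CurveClass ℂ)),
          Adapted 𝓕 (fun t c => drivingFunction φ c t) →
          (∀ w : ℂ, 0 < w.im →
            Martingale (fun t c => paraObsCap (drivingFunction φ c) w t) 𝓕 ν) →
        IsSLELaw ((8 : ℝ≥0) / 3) D ν := by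
  intro D φ ν hφ hν hdesc 𝓕 hWad hN
  have hWc : ∀ c : CurveClass ℂ, Continuous fun t ↦ drivingFunction φ c t := fun c ↦
    continuous_drivingFunction φ c
  have hW0 : ∀ᵐ c ∂ν, drivingFunction φ c 0 = 0 := by
    filter_upwards [hdesc] with c hc
    exact drivingFunction_apply_zero hφ hc.2
  have h83 : (0 : ℝ≥0) < 8 / 3 := by norm_num
  have h83' : ((8 / 3 : ℝ≥0) : ℝ) = 8 / 3 := by norm_num
  -- order one: the imaginary part of the capped observable seen from `iy`, `y → ∞`
  have h1 : ∀ K : ℝ, 0 < K → ∀ T : ℝ≥0, ∀ ε : ℝ, 0 < ε →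
      ∃ (Y : ℝ≥0 → CurveClass ℂ → ℝ) (a b : ℝ), a ≠ 0 ∧ Martingale Y 𝓕 ν ∧
        (∀ c, Continuous (Y · c)) ∧ ∀ᵐ c ∂ν, ∀ r : ℝ≥0, r ≤ T →
          (∀ u, u ≤ r → |drivingFunction φ c u| ≤ K) →
            |Y r c - (a * drivingFunction φ c r + b)| ≤ ε * |a| := by
    intro K hK T ε hε
    obtain ⟨y, hy, hP⟩ := exists_level_paraObsCap_order_one hK.le T hε
    have him : 0 < (Complex.I * (y : ℂ)).im := by simpa using hy
    refine ⟨fun t c ↦ (paraObsCap (drivingFunction φ c) (Complex.I * y) t).im,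
      -(5 / (4 * y)), 0, ?_, martingale_im_of_complex (hN _ him),
      fun c ↦ Complex.continuous_im.comp (continuous_paraObsCap (hWc c) hy),
      ae_of_all _ fun c r hr hbd ↦ hP _ (hWc c) r hr hbd⟩
    have : (0 : ℝ) < 5 / (4 * y) := by positivity
    exact neg_ne_zero.2 this.ne'
  -- order two: the real part of the capped observable seen from `iy`, `y → ∞`
  have h2 : ∀ K : ℝ, 0 < K → ∀ T : ℝ≥0, ∀ ε : ℝ, 0 < ε →
      ∃ (Y : ℝ≥0 → CurveClass ℂ → ℝ) (a b : ℝ), a ≠ 0 ∧ Martingale Y 𝓕 ν ∧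
        (∀ c, Continuous (Y · c)) ∧ ∀ᵐ c ∂ν, ∀ r : ℝ≥0, r ≤ T →
          (∀ u, u ≤ r → |drivingFunction φ c u| ≤ K) →
            |Y r c - (a * (drivingFunction φ c r ^ 2 - ((8 / 3 : ℝ≥0) : ℝ) * r) + b)| ≤ ε * |a| := by
    intro K hK T ε hε
    obtain ⟨y, hy, hP⟩ := exists_level_paraObsCap_order_two hK.le T hε
    have him : 0 < (Complex.I * (y : ℂ)).im := by simpa using hy
    refine ⟨fun t c ↦ (paraObsCap (drivingFunction φ c) (Complex.I * y) t).re,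
      -(45 / (32 * y ^ 2)), 1, ?_, martingale_re_of_complex (hN _ him),
      fun c ↦ Complex.continuous_re.comp (continuous_paraObsCap (hWc c) hy),
      ae_of_all _ fun c r hr hbd ↦ by rw [h83']; exact hP _ (hWc c) r hr hbd⟩
    have : (0 : ℝ) < 45 / (32 * y ^ 2) := by positivity
    exact neg_ne_zero.2 this.ne'
  haveI := hν
  obtain ⟨hM, hQ⟩ :=
    Literature.Probability.Process.isLocalMartingale_hasQuadraticVariation_of_approx
      (W := fun t c ↦ drivingFunction φ c t) (P := ν) hWad hWc hW0 h83 h1 h2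
  refine isSLELaw_of_isLocalMartingale_driving_of_lt_four h83 (by norm_num) hφ
    (measurable_drivingFunction_apply hφ) hW0 (ae_of_all _ fun c ↦ continuous_drivingFunction φ c)
    hM hQ ?_
  filter_upwards [hdesc] with c hc
  exact (isLoewnerDescribed_iff_isDrivenBy.1 (isLoewnerDescribed_drivingFunction hc.1)).2

end Summit.CriticalPhenomena.SAWScalingLimit.Theorems.SubseqIdentification.ParaMartingale

end
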